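import Summits.Ventures.HodgeRepro2.T5KTypeProjector
import Summits.Ventures.HodgeRepro2.T5WeightSpaces

/-!
# The weight projector `∫ conj χ(k) π(k) dk` onto the weight space of a character

Tier-5 support (N4.3 = (R3), step (P2′): the `SO(2)`-weights / `K`-types of a representation;
route/T5-SUPPORT-p1.md §S4.11–§S4.12).  For a compact Hausdorff group `K`, a bi-invariant
probability measure `μ` (e.g. `haarProb K`), a continuous finite-dimensional `π` and a continuous
character `χ : K →* ℂˣ`, the `K`-type projector of `T5KTypeProjector` for the one-dimensional
representation `charRep χ` is

  `weightProj μ π χ v = ∫ conj (χ k) • π k v ∂μ`  (`weightProj_apply`),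

and it is the projector onto the weight space `weightSpace π χ = {v | π k v = χ k • v}`:
`range_weightProj`, `weightProj_apply_eq_self_iff`, `weightProj_idempotent`, `weightProj_comm`
(via `T5WeightSpaces.isotypic_charRep_eq_weightSpace`).  For `K = SO(2)` and `χ = e^{inθ}` this is
the Fourier-coefficient projector onto the `n`-th `K`-type — the finite-dimensional form of the
«K-type projection» of (P2′).

What this file does NOT say: anything about the infinite-dimensional `π₃⁺` ([C] in N4.3).

Blind lane: Mathlib + own prefix; no sorry; axioms ⊆ {propext, Classical.choice, Quot.sound}.
-/

namespace Summit.Ventures.HodgeRepro2.T5WeightProjector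

open MeasureTheory
open Summit.Ventures.HodgeRepro2.T5SchurOrthogonality Summit.Ventures.HodgeRepro2.T5WeightSpaces
  Summit.Ventures.HodgeRepro2.T5KTypeProjector Summit.Ventures.HodgeRepro2.T5IsotypicCopies

variable {K : Type*} [Group K] [TopologicalSpace K] [IsTopologicalGroup K] [MeasurableSpace K]
  [BorelSpace K] [CompactSpace K]
variable {V : Type*} [NormedAddCommGroup V] [InnerProductSpace ℂ V] [FiniteDimensional ℂ V]
variable (μ : Measure K) [IsProbabilityMeasure μ] [μ.IsMulLeftInvariant] [μ.IsMulRightInvariant]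
variable (π : K →* V →L[ℂ] V) (χ : K →* ℂˣ)

/-- The weight projector: the `K`-type projector of the one-dimensional representation
`charRep χ`. -/
noncomputable def weightProj (hπ : Continuous π) (hχ : Continuous fun k => (χ k : ℂ)) :
    V →ₗ[ℂ] V :=
  charProj μ π (charRep χ) hπ (continuous_charRep χ hχ)

omit [IsTopologicalGroup K] [FiniteDimensional ℂ V] [μ.IsMulLeftInvariant]
  [μ.IsMulRightInvariant] in
/-- `weightProj μ π χ v = ∫ conj (χ k) • π k v ∂μ`. -/
theorem weightProj_apply (hπ : Continuous π) (hχ : Continuous fun k => (χ k : ℂ)) (v : V) :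
    weightProj μ π χ hπ hχ v = ∫ k, (starRingEnd ℂ) (χ k : ℂ) • π k v ∂μ := by
  rw [weightProj, charProj_apply]
  simp only [character_charRep, Module.finrank_self, Nat.cast_one, one_smul]

/-- The weight projector commutes with the representation. -/
theorem weightProj_comm (hπ : Continuous π) (hχ : Continuous fun k => (χ k : ℂ)) (h : K) (v : V) :
    weightProj μ π χ hπ hχ (π h v) = π h (weightProj μ π χ hπ hχ v) :=
  charProj_comm μ π (charRep χ) hπ _ h v

variable [μ.IsOpenPosMeasure]

/-- **The range of the weight projector is the weight space.** -/
theorem range_weightProj (hπ : Continuous π) (hχ : Continuous fun k => (χ k : ℂ)) :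
    LinearMap.range (weightProj μ π χ hπ hχ) = weightSpace π χ := by
  rw [weightProj, range_charProj μ π (charRep χ) hπ _ (isIrreducible_charRep χ),
    isotypic_charRep_eq_weightSpace]

/-- `weightProj v = v` exactly on the weight space. -/
theorem weightProj_apply_eq_self_iff (hπ : Continuous π) (hχ : Continuous fun k => (χ k : ℂ))
    (v : V) : weightProj μ π χ hπ hχ v = v ↔ v ∈ weightSpace π χ := by
  rw [weightProj, charProj_apply_eq_self_iff μ π (charRep χ) hπ _ (isIrreducible_charRep χ),
    isotypic_charRep_eq_weightSpace]

/-- The weight projector lands in the weight space. -/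
theorem weightProj_apply_mem (hπ : Continuous π) (hχ : Continuous fun k => (χ k : ℂ)) (v : V) :
    weightProj μ π χ hπ hχ v ∈ weightSpace π χ := by
  rw [← range_weightProj μ π χ hπ hχ]
  exact ⟨v, rfl⟩

/-- The weight projector is idempotent. -/
theorem weightProj_idempotent (hπ : Continuous π) (hχ : Continuous fun k => (χ k : ℂ)) (v : V) :
    weightProj μ π χ hπ hχ (weightProj μ π χ hπ hχ v) = weightProj μ π χ hπ hχ v :=
  (weightProj_apply_eq_self_iff μ π χ hπ hχ _).mpr (weightProj_apply_mem μ π χ hπ hχ v)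

/-- A weight vector is fixed by its weight projector. -/
theorem weightProj_apply_of_mem (hπ : Continuous π) (hχ : Continuous fun k => (χ k : ℂ)) {v : V}
    (hv : ∀ k, π k v = (χ k : ℂ) • v) : weightProj μ π χ hπ hχ v = v :=
  (weightProj_apply_eq_self_iff μ π χ hπ hχ v).mpr ((mem_weightSpace π χ).mpr hv)

end Summit.Ventures.HodgeRepro2.T5WeightProjector
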